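import Literature.Barriers.AtomisticToContinuum.DisorderedHarmonicChainLyapunovPos
import Literature.Probability.RandomMatrixProducts.AndersonModel1DPositivity
import HarnessLib

/-!
# Ajanki–Huveneers 2011: the high-frequency term (H) and O'Connor's amplitude bound, UNCONDITIONALLY

Companion to `DisorderedHarmonicChainLyapunovPos.lean` (the Casher–Lebowitz / Ajanki–Huveneers
cluster of `Literature/Barriers/AtomisticToContinuum/`; root fact `AjankiHuveneers2011_scaling`,
Thm 1.1 of O. Ajanki, F. Huveneers, CMP **301** (2011) 841–883, arXiv:1003.1076). That file reduced
the high-frequency bound (H) `AjankiHuveneers2011_highFrequencyBound` (the term `𝒥₃` of AH2011 §6.2,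
taken there from O'Connor 1975, Thm 6) and O'Connor's amplitude bound `OConnor1975_amplitudeBound`
to ONE vendored fact, Fürstenberg positivity of the Lyapunov exponent of the one-dimensional
Anderson model (`BucajEtAl2019_lyapunovPos`, Bucaj et al. TAMS **372** (2019) Thm 2.3), used only at
energy `E = 2` for the laws of the potentials `ω² m_k`.

Those laws are ABSOLUTELY CONTINUOUS with a bounded density (`≤ ‖τ‖_∞/ω²`) and bounded support
(`[-bω², bω²]`), and for such single-site laws positivity of the Lyapunov exponent is now a THEOREM
of the tree: `andersonLyapunov_pos_of_density` (`AndersonModel1DPositivity.lean`, a quantitative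
form of Fürstenberg's entropy argument). Hence, with no hypothesis left:

* `chain_logMoment_ge_two` — the pointwise core `∃ N, ∀ unit v, 𝔼 log ‖Q_N(ω) v‖ ≥ 2` at every `ω > 0`;
* `AjankiHuveneers2011_highFrequencyBound_holds` — (H) DISCHARGED;
* `OConnor1975_amplitudeBound_holds` — O'Connor's bound (39) DISCHARGED;
* `AjankiHuveneers2011_scaling_of_lowFrequency :
     AjankiHuveneers2011_lowFrequencyBound → AjankiHuveneers2011_criticalBandLowerBound →
     AjankiHuveneers2011_scaling`.

So the trust base of the vendored barrier fact `AjankiHuveneers2011_scaling` is now exactly the two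
low-frequency bounds (U), (L) of AH2011 §6 (the paper's own §§3–5 machinery); the steady state,
the current formula, the transfer-matrix reduction, (H) and the Lyapunov positivity it rests on
are proved.
-/

noncomputable section

open MeasureTheory Filter Set
open scoped Matrix.Norms.L2Operator Matrix ENNReal

namespace Literature.Barriers.AtomisticToContinuum.HeatConduction

open Literature.Probability.RandomMatrixProducts

/-- **The pointwise core, unconditionally.** For every admissible mass density and every
frequency `ω > 0` there is a scale `N ≥ 1` with `𝔼 log ‖Q_N(ω) v‖ ≥ 2` for every unit vector `v`:
the law of the potentials `ω² m_k` has density `≤ (‖τ‖_∞ + 1)/ω²` on intervals and support in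
`[-bω², bω²]`, so its Lyapunov exponent at `E = 2` is positive (`andersonLyapunov_pos_of_density`)
and two-step direction smoothing (`exists_scale_logMoment_ge_two`) gives the scale.
[cite: AjankiHuveneers2011, §2 ¶3 (the input taken from O'Connor 1975, Thm 6)] -/
theorem chain_logMoment_ge_two {τ : ℝ → ℝ} {a b : ℝ} (hyp : MassDensityHyp τ a b)
    {ρ : Measure ℝ} [IsProbabilityMeasure ρ]
    (hρ : ρ = volume.withDensity fun s => ENNReal.ofReal (τ s)) {ω : ℝ} (hω0 : 0 < ω) :
    ∃ N : ℕ, 1 ≤ N ∧ ∀ v : EuclideanSpace ℝ (Fin 2), ‖v‖ = 1 →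
      2 ≤ ∫ m, Real.log ‖Matrix.toEuclideanLin (andersonTransferProd 2 (padSeq (ω ^ 2 • m)) N) v‖
        ∂(Measure.pi fun _ : Fin N => ρ) := by
  have hb : 0 ≤ b := hyp.pos.le.trans hyp.lt.le
  have hc : 0 < ω ^ 2 := pow_pos hω0 2
  set ν : Measure ℝ := ρ.map fun x => ω ^ 2 * x with hν
  haveI : IsProbabilityMeasure ν := isProbabilityMeasure_map_smul ρ _
  obtain ⟨T, hT0, hT⟩ := hyp.exists_upper_bound
  have hK : ∀ p q : ℝ, ν (Set.Icc p q) ≤ ENNReal.ofReal (T / ω ^ 2 * (q - p)) :=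
    map_smul_Icc_le hρ hT0 hT hc
  have hK1 : ∀ p q : ℝ, ν (Set.Icc p q) ≤ ENNReal.ofReal ((T + 1) / ω ^ 2 * (q - p)) := by
    intro p q
    rcases le_or_gt p q with hpq | hpq
    · refine (hK p q).trans (ENNReal.ofReal_le_ofReal ?_)
      exact mul_le_mul_of_nonneg_right (div_le_div_of_nonneg_right (by linarith) hc.le) (sub_nonneg.mpr hpq)
    · rw [Set.Icc_eq_empty (not_le.mpr hpq), measure_empty]
      exact bot_le
  have hR : ∀ᵐ x ∂ν, |x| ≤ b * ω ^ 2 := ae_map_smul_abs_le hyp hρ hc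
  have hLpos : 0 < andersonLyapunov ν 2 :=
    andersonLyapunov_pos_of_density (K := (T + 1) / ω ^ 2) (by positivity) hK1 hR 2
  obtain ⟨N, hN1, hcore⟩ :=
    exists_scale_logMoment_ge_two (μ := ν) (by positivity) hK hR (by positivity) 2 hLpos
  refine ⟨N, hN1, fun v hv => ?_⟩
  have h := hcore v hv
  -- transport the integral from the i.i.d. potentials to the i.i.d. masses
  have hmeas : Measurable fun α : Fin N → ℝ =>
      Real.log ‖Matrix.toEuclideanLin (andersonTransferProd 2 (padSeq α) N) v‖ :=
    (measurable_norm_andersonTransferProd_apply 2 N v).log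
  rw [hν, ← pi_map_smul ρ (ω ^ 2) N, integral_map (by fun_prop : Measurable fun m : Fin N → ℝ =>
    (ω ^ 2) • m).aemeasurable hmeas.aestronglyMeasurable] at h
  exact h

end Literature.Barriers.AtomisticToContinuum.HeatConduction

namespace Literature.Barriers.AtomisticToContinuum

open HeatConduction Literature.Probability.RandomMatrixProducts

/-- **(H) DISCHARGED.** The high-frequency bound `∫_{ω₀}^∞ 𝔼 j_n ≤ C e^{-c√n}` of the
Ajanki–Huveneers decomposition (the term `𝒥₃` of AH2011 §6.2, which the paper takes from
O'Connor 1975, Thm 6) holds unconditionally: the pointwise core `chain_logMoment_ge_two` (from the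
proved positivity of the Lyapunov exponent for absolutely continuous site laws) fed into
`AjankiHuveneers2011_highFrequencyBound_of_core`.
[cite: AjankiHuveneers2011, §2 ¶3 and §6.2 (the term `𝒥₃`)] -/
theorem AjankiHuveneers2011_highFrequencyBound_holds : AjankiHuveneers2011_highFrequencyBound :=
  AjankiHuveneers2011_highFrequencyBound_of_core fun _τ _a _b hyp _ρ _ hρ _ω hω =>
    chain_logMoment_ge_two hyp hρ hω

/-- **O'Connor's amplitude bound (39) DISCHARGED**: `ℙ(t_n² ≤ e^{γn}) ≤ C e^{-α√n}` uniformly on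
compact frequency bands (vendored in `DisorderedHarmonicChainHighFrequency.lean`), from the
pointwise core via `OConnor1975_amplitudeBound_of_core`. [cite: OConnor1975, §3 eq. (39)] -/
theorem OConnor1975_amplitudeBound_holds : OConnor1975_amplitudeBound :=
  OConnor1975_amplitudeBound_of_core fun _τ _a _b hyp _ρ _ hρ _ω hω =>
    chain_logMoment_ge_two hyp hρ hω

/-- **The root fact on its final reduced trust base.** The vendored barrier fact
`AjankiHuveneers2011_scaling` (Ajanki–Huveneers 2011, Thm 1.1, SDE side) follows from exactly the
two low-frequency bounds of AH2011 §6: (U) `AjankiHuveneers2011_lowFrequencyBound` and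
(L) `AjankiHuveneers2011_criticalBandLowerBound`; the steady state, the current formula, the
transfer-matrix reduction, the high-frequency bound (H) and the Lyapunov positivity behind it are
proved in this cluster. [cite: AjankiHuveneers2011, Thm 1.1, §2.1 eqs. (2.5)-(2.7), §6] -/
theorem AjankiHuveneers2011_scaling_of_lowFrequency (hU : AjankiHuveneers2011_lowFrequencyBound)
    (hL : AjankiHuveneers2011_criticalBandLowerBound) : AjankiHuveneers2011_scaling :=
  AjankiHuveneers2011_scaling_of_spectralScaling
    (AjankiHuveneers2011_spectralScaling_of_bounds hU AjankiHuveneers2011_highFrequencyBound_holds hL)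

end Literature.Barriers.AtomisticToContinuum
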